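import Mathlib
import Summits.ResolutionOfSingularities.ResolutionOfSingularities.Theorems.RadicialJungCleanModelsBirthDescent
import HarnessLib

/-!
# Route `RadicialJung`, crux `CleanModels` (stmt-ResolutionOfSingularities-15917), line `Sketch` rev 35, stub 6 `stub_cleanProp44` (X44c),
# `τ = 1` residual: (B2)-BIRTHS ON NEAR LINES HAVE `ν ≤ 2` AND ARE RATIONAL (memo 4e §2.4 (B2), §2.5 last bullet)

Seat decomp-res-hand-2 g12 (structural hand); seventh brick.  Memo `Cruxes/CleanModels/Lines/Sketch-memo-4e-cleanPermissible.md` §2.5 (last bullet):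
«for a birth `c'` on a near line `ℓ_x ⊂ E_x` (uncharged plane, three charged sides), `τ(x) = 1` gives `f₁|_{E_x} = C·z̄^μ` … so
`δ*(c') ≤` (contact of `ℓ_x` with the p-prepared leaf) `= 1 + ord_{c'} d(U|_{ℓ_x}) ≤ 2` (§2.4 (B2): the numerator has degree `≤ 1`); hence a (B2)-birth breeds at
most once, and only when `p = 2`».  Here `U|_ℓ = u ∏_{i} l_i^{a_i}` (`u = u(x) ∈ κ(x)` — pulled-back units are constant on `E_x` —, `l_i = β_i t + γ_i` the `r ≤ 3`
charged sides, `a_i ≥ 1`, `p ∣ Σ a_i`), and ✓ `…BirthDescent.lean` §5 gives `(∏ l_i^{a_i})' = N · ∏ l_i^{a_i − 1}` with `deg N ≤ r − 2`.  This file combines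
that with §1 there (`π^{k+1} ∣ F − G^p ⟹ π^k ∣ F'`):

* `births_line_mul_natDegree_le` — for a closed point `π` OFF THE SIDES (`π ∤ l_i`) with `π^n ∣ U|_ℓ − G^p` and `N ≠ 0` (`ℓ` not `W`-invariant):
  `(n − 1)·deg π ≤ r − 2`.
* `births_line_le_two` — with `r ≤ 3`: `n ≤ 2` (so `ν(c') ≤ 2`, `δ*(c') ≤ 2`: breeding needs `δ* ∈ pℤ_{≥ p}`, i.e. `p = 2`), and
  `births_line_le_one_of_two_le_natDegree`: a point of degree `≥ 2` has `n ≤ 1` — (B2)-births are RATIONAL points; `births_line_le_one_of_card_le_two`: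
  over `r ≤ 2` charged sides there is no tangency point off the sides at all (`n ≤ 1`).

Honest framing: OURS, elementary; dictionary (near lines, charged sides, `U|_ℓ`, `ν`, `δ*`) NOT formalized; nothing here proves (B′), X44c, any case of
`CleanModels`, or resolution of singularities in characteristic `p`.  Setting only: [cite: CossartPiltant2008, Lemma 4.3 (5)] [cite: CossartJannsenSaito2020, Lemma 5.25].
-/

set_option linter.dupNamespace false -- mandated namespace of this single-conjunct summit

open Polynomial Finset

namespace Summit.ResolutionOfSingularities.ResolutionOfSingularities.Theorems.RadicialJung.CleanModels

/-- **`(n − 1)·deg π ≤ r − 2` at a point off the sides**: `K` a field of characteristic `p`, `l_i = β_i u + γ_i` (`i ∈ s`, `r = |s|`), `a_i ≥ 1`, `p ∣ Σ a_i`,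
`u₀ ≠ 0` a constant, `F = u₀ ∏ l_i^{a_i}`; `π` irreducible dividing no `l_i`, the log-numerator `N ≠ 0`, and `π^n ∣ F − G^p`.  Then `π^{n−1} ∣ N`, so
`(n − 1)·deg π ≤ deg N ≤ r − 2`. [folklore] -/
theorem births_line_mul_natDegree_le {K : Type*} [Field K] (p : ℕ) [CharP K p] {ι : Type*} [DecidableEq ι] (s : Finset ι)
    (β γ : ι → K) (a : ι → ℕ) (ha : ∀ i ∈ s, 1 ≤ a i) (hsum : p ∣ ∑ i ∈ s, a i) {u₀ : K} (hu₀ : u₀ ≠ 0)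
    {π G : K[X]} (hπ : Irreducible π) (hoff : ∀ i ∈ s, ¬ π ∣ C (β i) * X + C (γ i))
    (hN : (∑ i ∈ s, C ((a i : K) * β i) * ∏ j ∈ s.erase i, (C (β j) * X + C (γ j))) ≠ 0)
    {n : ℕ} (hn : π ^ n ∣ C u₀ * ∏ i ∈ s, (C (β i) * X + C (γ i)) ^ a i - G ^ p) :
    (n - 1) * π.natDegree ≤ s.card - 2 := by
  -- `π^{n-1} ∣ F'`
  have hF' : π ^ (n - 1) ∣ derivative (C u₀ * ∏ i ∈ s, (C (β i) * X + C (γ i)) ^ a i) := by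
    rcases Nat.eq_zero_or_pos n with h0 | hpos
    · rw [h0]
      simp
    · obtain ⟨k, rfl⟩ : ∃ k, n = k + 1 := ⟨n - 1, by omega⟩
      rw [Nat.add_sub_cancel]
      exact births_pow_dvd_derivative_of_pow_succ_dvd_sub_pow p hn
  -- `F' = C u₀ * (N * ∏ l_i^{a_i - 1})`
  rw [derivative_mul, derivative_C, zero_mul, zero_add, births_derivative_prod_linear_pow s β γ a ha] at hF'
  -- `π^{n-1}` is coprime to `C u₀` and to `∏ l_i^{a_i-1}`
  have hcopC : IsCoprime (π ^ (n - 1)) (C u₀) := by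
    have h := (isCoprime_mul_unit_left_right (isUnit_C.mpr (Ne.isUnit hu₀)) (π ^ (n - 1)) 1).mpr isCoprime_one_right
    rwa [mul_one] at h
  have hcopP : IsCoprime (π ^ (n - 1)) (∏ i ∈ s, (C (β i) * X + C (γ i)) ^ (a i - 1)) :=
    IsCoprime.prod_right fun i hi => ((hπ.coprime_iff_not_dvd.mpr (hoff i hi)).pow_left).pow_right
  have hdvdN : π ^ (n - 1) ∣ ∑ i ∈ s, C ((a i : K) * β i) * ∏ j ∈ s.erase i, (C (β j) * X + C (γ j)) := by
    have h1 := hcopC.dvd_of_dvd_mul_left hF'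
    exact hcopP.dvd_of_dvd_mul_right h1
  calc (n - 1) * π.natDegree = (π ^ (n - 1)).natDegree := (natDegree_pow _ _).symm
    _ ≤ (∑ i ∈ s, C ((a i : K) * β i) * ∏ j ∈ s.erase i, (C (β j) * X + C (γ j))).natDegree := natDegree_le_of_dvd hdvdN hN
    _ ≤ s.card - 2 := births_natDegree_logNumerator_le p s β γ a hsum

/-- **(B2)-births have `ν ≤ 2`**: with at most three charged sides (`|s| ≤ 3`), `n ≤ 2` for every point off the sides with `π^n ∣ F − G^p` (memo 4e §2.5:
`δ*(c') ≤ 2`, so a (B2)-birth breeds at most once and only when `p = 2`). [folklore] -/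
theorem births_line_le_two {K : Type*} [Field K] (p : ℕ) [CharP K p] {ι : Type*} [DecidableEq ι] (s : Finset ι) (hs : s.card ≤ 3)
    (β γ : ι → K) (a : ι → ℕ) (ha : ∀ i ∈ s, 1 ≤ a i) (hsum : p ∣ ∑ i ∈ s, a i) {u₀ : K} (hu₀ : u₀ ≠ 0)
    {π G : K[X]} (hπ : Irreducible π) (hoff : ∀ i ∈ s, ¬ π ∣ C (β i) * X + C (γ i))
    (hN : (∑ i ∈ s, C ((a i : K) * β i) * ∏ j ∈ s.erase i, (C (β j) * X + C (γ j))) ≠ 0)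
    {n : ℕ} (hn : π ^ n ∣ C u₀ * ∏ i ∈ s, (C (β i) * X + C (γ i)) ^ a i - G ^ p) : n ≤ 2 := by
  have h := births_line_mul_natDegree_le p s β γ a ha hsum hu₀ hπ hoff hN hn
  have hdeg : 0 < π.natDegree := hπ.natDegree_pos
  have h1 : n - 1 ≤ 1 := le_trans (Nat.le_mul_of_pos_right _ hdeg) (h.trans (by omega))
  omega

/-- **(B2)-births are rational points**: a closed point of degree `≥ 2` off the sides has `n ≤ 1` (it is not a birth: `ν ≤ 1`). [folklore] -/
theorem births_line_le_one_of_two_le_natDegree {K : Type*} [Field K] (p : ℕ) [CharP K p] {ι : Type*} [DecidableEq ι] (s : Finset ι)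
    (hs : s.card ≤ 3) (β γ : ι → K) (a : ι → ℕ) (ha : ∀ i ∈ s, 1 ≤ a i) (hsum : p ∣ ∑ i ∈ s, a i) {u₀ : K} (hu₀ : u₀ ≠ 0)
    {π G : K[X]} (hπ : Irreducible π) (h2 : 2 ≤ π.natDegree) (hoff : ∀ i ∈ s, ¬ π ∣ C (β i) * X + C (γ i))
    (hN : (∑ i ∈ s, C ((a i : K) * β i) * ∏ j ∈ s.erase i, (C (β j) * X + C (γ j))) ≠ 0)
    {n : ℕ} (hn : π ^ n ∣ C u₀ * ∏ i ∈ s, (C (β i) * X + C (γ i)) ^ a i - G ^ p) : n ≤ 1 := by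
  have h := births_line_mul_natDegree_le p s β γ a ha hsum hu₀ hπ hoff hN hn
  have h1 : (n - 1) * 2 ≤ 1 := le_trans (Nat.mul_le_mul_left _ h2) (h.trans (by omega))
  omega

/-- **No tangency point over `r ≤ 2` charged sides**: with `|s| ≤ 2` every point off the sides has `n ≤ 1` (memo 4e §2.4 (B2): «`r = 2` ⟹ NO tangency
point off the sides (or `ℓ` is `W`-invariant)»). [folklore] -/
theorem births_line_le_one_of_card_le_two {K : Type*} [Field K] (p : ℕ) [CharP K p] {ι : Type*} [DecidableEq ι] (s : Finset ι)
    (hs : s.card ≤ 2) (β γ : ι → K) (a : ι → ℕ) (ha : ∀ i ∈ s, 1 ≤ a i) (hsum : p ∣ ∑ i ∈ s, a i) {u₀ : K} (hu₀ : u₀ ≠ 0)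
    {π G : K[X]} (hπ : Irreducible π) (hoff : ∀ i ∈ s, ¬ π ∣ C (β i) * X + C (γ i))
    (hN : (∑ i ∈ s, C ((a i : K) * β i) * ∏ j ∈ s.erase i, (C (β j) * X + C (γ j))) ≠ 0)
    {n : ℕ} (hn : π ^ n ∣ C u₀ * ∏ i ∈ s, (C (β i) * X + C (γ i)) ^ a i - G ^ p) : n ≤ 1 := by
  have h := births_line_mul_natDegree_le p s β γ a ha hsum hu₀ hπ hoff hN hn
  have hdeg : 0 < π.natDegree := hπ.natDegree_pos
  have h1 : n - 1 ≤ 0 := le_trans (Nat.le_mul_of_pos_right _ hdeg) (h.trans (by omega))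
  omega

end Summit.ResolutionOfSingularities.ResolutionOfSingularities.Theorems.RadicialJung.CleanModels
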